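import Summits.BirchSwinnertonDyer.BirchSwinnertonDyer.Theorems.ManinLocalTwoThreeStevensCuspRational
import Literature.NumberTheory.EllipticCurves.Gamma1ParametrizationCuspZeroGaloisOrbit
import Literature.FieldTheory.AlgClosed.AutomorphismExtension
import HarnessLib

/-!
# The Galois orbit of the value at the cusp `0` of an `X₁(N)`-parametrisation — F♮ `optimalGamma1Parametrization_cuspZero_galoisConjugate` HOLDS
(route `ManinLocalTwoThree`, cruxes C2 `ManinOddAtFour` stmt-BirchSwinnertonDyer-22967 / C3 `ManinPrimeToThreeAtNine`; cell bsd-f2-manin;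
AUTHORED by planner es g42 (TURNKEY T-es-78, HOME/es/g42/StevensCuspZero-es-g42.lean sha16 f6c1f35f6c84bc8d, §§1–3 verbatim), landed by prover
seat p3 gen 21 `--supports stmt-BirchSwinnertonDyer-22967`; es's §4 (F★₀ `optimalParametrization_cuspZero_rational_holds`) is already in the tree as
p3's `StevensCurve.optimalParametrization_cuspZero_rational_holds` (`ManinLocalTwoThreeStevensCuspZeroRational.lean`, p767969) and is omitted here)

THEOREM (`optimalGamma1Parametrization_cuspZero_galoisConjugate_holds`, the named fact F♮ of
`Literature…Gamma1ParametrizationCuspZeroGaloisOrbit`, Stevens 1982 Thm 1.3.1 (b) at the cusp `0`; its hypothesis `D.IsOptimal` is not used).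
For every elliptic `W/ℚ`, every `X₁(N)`-datum `D` and every `γ = (a b; c δ) ∈ Γ₀(N)` there is `σ ∈ Aut_ℚ(ℂ)` with
`σ(u(c_D·{∞,0}_f)) = u(c_D·({∞,0}_f + {∞,γ∞}_f))` (`= u(c_D·{∞, γ0}_f)`).

ENGINE (`map_uniformize_cuspZero_general`).  For `σ ∈ Aut_ℚ(ℂ)` with `σ(ζ_N) = ζ_N^d`, `dd′ ≡ 1 (N)`, and ANY `γ ∈ Γ₀(N)` with `δ ≡ d′ (N)`:
`σ(u(c_D{∞,0})) = u(c_D({∞,0} + {∞,γ∞}))`.  Proof: Stevens (b) for general cusps (LEAD p1 g22's `StevensGalois.map_uniformize_cusp_general`,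
p767486) applied to the pair `S = (0,−1;1,0)` (cusp `0 = S∞`) and `γ′ = γ·T^j·S = (b+ja, −a; δ+jc, −c)` with `j ≡ −bδ (N)` chosen so that
`δ + jc ≠ 0`: then `γ′ ≡ (0, −d; d′, 0) = diag(1,d′)·S·diag(1,d) (mod N)` because `a ≡ d`, `δ ≡ d′`, `c ≡ 0`, and `γ′∞ = γ·j`, so Manin's
relation `{∞, γj}_f = {∞,γ∞}_f + {∞,j}_f` (`modularSymbol_gamma0_smul_holds`) and `{∞,j}_f = {∞,0}_f` (`modularSymbol_add_intCast_holds`) finish.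
F♮ follows with `d = a`, `d′ = δ` and an automorphism of `ℂ` with `σ(ζ_N) = ζ_N^a` (`exists_algEquiv_exp_eq`: the primitive `N`-th roots of
unity are `Aut(ℂ)`-conjugate, `Literature.FieldTheory.AlgClosed.Complex.exists_ringEquiv_apply_eq_of_aeval_minpoly_eq_zero` +
`cyclotomic_eq_minpoly_rat`).  CONVERSE (`exists_gamma0_map_uniformize_cuspZero`): every `σ ∈ Aut_ℚ(ℂ)` moves `u(c_D{∞,0})` to some
`u(c_D({∞,0} + {∞,γ∞}))`, `γ ∈ Γ₀(N)` — the orbit of the cusp-`0` value IS `{u(c_D{∞,γ0}) : γ ∈ Γ₀(N)}` (both directions of Stevens (b) at `0`).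

(F★₀, the rationality of the cusp-`0` value on `X₀(N)`, is the sibling `ManinLocalTwoThreeStevensCuspZeroRational.lean`: the CONVERSE above with
`c_D{∞,γ∞}_f ∈ c_DΛ₀(f) ⊆ Λ_W` and the fixed field of `Aut_ℚ(ℂ)`.)

HONEST FRAMING.  Discharges the named Literature fact F♮ (statement-only so far; 6 tree files carry it as the hypothesis `hFnat`).  Nothing
about C2/C3, Manin's conjecture or BSD is proved here.  No definitions, no sorry.
[cite: Cremona1997Algorithms, §2.6 (p. 19) and §2.8 (pp. 25–26)] [cite: EdixhovenManin1991, §1] [cite: Ogg1983RealPoints, §2]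
[cite: Stevens1982, §1.3 Thm. 1.3.1 (b) and rules (1)–(2) (pp. 11–12)] [cite: ConradEdixhovenStein2003, §6.1.2 proof of Lemma 6.1.6 (p. 381)]
[cite: Manin1972, Prop. 1.4 / Thm. 1.6] [cite: Washington1997, Thm. 2.5]
-/

-- lint-debt: the directory name repeats the summit name (sibling precedent `ManinLocalTwoThreeStevensCuspRational.lean`)
set_option linter.dupNamespace false
set_option autoImplicit false

noncomputable section

open Complex Polynomial
open scoped Real MatrixGroups PeriodPair
open CongruenceSubgroup
open Literature.NumberTheory.EllipticCurves Literature.NumberTheory.EllipticCurves.ModularForms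

namespace Summit.BirchSwinnertonDyer.BirchSwinnertonDyer.Theorems.ManinLocalTwoThree.StevensGalois

variable {N : ℕ} [NeZero N]

/-! ## §1 Automorphisms of `ℂ` with prescribed cyclotomic character -/

/-- **Every unit `a` mod `N` is the exponent of some `σ ∈ Aut_ℚ(ℂ)` on `ζ_N = e^{2πi/N}`**: the primitive `N`-th roots of unity are the roots of
the irreducible `Φ_N ∈ ℚ[X]`, hence `Aut(ℂ)`-conjugate. [cite: Washington1997, Thm. 2.5] -/
theorem exists_algEquiv_exp_eq {a : ℤ} (ha : IsUnit ((a : ℤ) : ZMod N)) :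
    ∃ σ : ℂ ≃ₐ[ℚ] ℂ, σ (cexp (2 * π * Complex.I / N)) = cexp (2 * π * Complex.I * a / N) := by
  have hζ : IsPrimitiveRoot (cexp (2 * π * Complex.I / N)) N := Complex.isPrimitiveRoot_exp N (NeZero.ne N)
  have hpos : 0 < N := Nat.pos_of_ne_zero (NeZero.ne N)
  have hint : IsIntegral ℚ (cexp (2 * π * Complex.I / N)) := (hζ.isIntegral hpos).tower_top
  set k : ℕ := ((a : ℤ) : ZMod N).val with hk
  have hcop : k.Coprime N := by
    have h := ZMod.val_coe_unit_coprime ha.unit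
    rwa [IsUnit.unit_spec] at h
  have hroot : aeval (cexp (2 * π * Complex.I / N) ^ k) (minpoly ℚ (cexp (2 * π * Complex.I / N))) = 0 := by
    rw [← cyclotomic_eq_minpoly_rat hζ hpos, aeval_def, ← Polynomial.eval_map, map_cyclotomic, ← IsRoot.def,
      isRoot_cyclotomic_iff]
    exact hζ.pow_of_coprime k hcop
  obtain ⟨τ, hτ⟩ :=
    Literature.FieldTheory.AlgClosed.Complex.exists_ringEquiv_apply_eq_of_aeval_minpoly_eq_zero hint hroot
  refine ⟨AlgEquiv.ofRingEquiv (f := τ) (fun q ↦ by rw [eq_ratCast, map_ratCast]), ?_⟩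
  rw [AlgEquiv.ofRingEquiv_apply, hτ, ← Complex.exp_nat_mul, Complex.exp_eq_exp_iff_exists_int]
  refine ⟨-(a / N), ?_⟩
  have hkZ : (k : ℤ) = a - N * (a / N) := by rw [hk, ZMod.val_intCast, Int.emod_def]
  have hkC : (k : ℂ) = (a : ℂ) - (N : ℂ) * ((a / N : ℤ) : ℂ) := by exact_mod_cast hkZ
  have hN : (N : ℂ) ≠ 0 := by exact_mod_cast NeZero.ne N
  rw [hkC]
  field_simp
  push_cast
  ring

/-! ## §2 The engine: Stevens (b) at the cusp `0` -/

/-- **Stevens 1982 Thm 1.3.1 (b) at the cusp `0` of `X₁(N)`.**  For an `X₁(N)`-datum `D`, `σ ∈ Aut_ℚ(ℂ)` with `σ(e^{2πi/N}) = e^{2πid/N}`,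
`dd′ ≡ 1 (N)`, and every `γ ∈ Γ₀(N)` whose lower-right entry is `≡ d′ (mod N)`:
`σ(u(c·{∞,0}_f)) = u(c·({∞,0}_f + {∞,γ∞}_f))` — the conjugate of the cusp-`0` value is the value at the cusp `γ·0`.
[cite: Stevens1982, §1.3 Thm. 1.3.1 (b)] [cite: Manin1972, Prop. 1.4 / Thm. 1.6] -/
theorem map_uniformize_cuspZero_general {W : WeierstrassCurve ℚ} [W.IsElliptic] (D₁ : Gamma1ParametrizationData W N)
    (σ : ℂ ≃ₐ[ℚ] ℂ) {d d' : ℤ} (hdd : ((d * d' : ℤ) : ZMod N) = 1)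
    (hσ : σ (cexp (2 * π * Complex.I / N)) = cexp (2 * π * Complex.I * d / N))
    (γ : Gamma0 N) (hγd : (((γ : SL(2, ℤ)) 1 1 : ℤ) : ZMod N) = (d' : ZMod N)) :
    WeierstrassCurve.Affine.Point.map (W' := W) (σ : ℂ →ₐ[ℚ] ℂ)
        (D₁.uniformize ((D₁.c : ℂ) * modularSymbol D₁.f 0)) =
      D₁.uniformize ((D₁.c : ℂ) * (modularSymbol D₁.f 0 + cuspSymbol D₁.f γ)) := by
  classical
  -- entries of `γ`
  set a : ℤ := (γ : SL(2, ℤ)) 0 0 with ha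
  set b : ℤ := (γ : SL(2, ℤ)) 0 1 with hb
  set c : ℤ := (γ : SL(2, ℤ)) 1 0 with hc
  set δ : ℤ := (γ : SL(2, ℤ)) 1 1 with hδ
  have hdet : a * δ - b * c = 1 := by
    rw [ha, hb, hc, hδ, ← Matrix.det_fin_two, (γ : SL(2, ℤ)).det_coe]
  have hcN : (c : ZMod N) = 0 := by rw [hc]; exact Gamma0_mem.mp γ.2
  have haδ : (a : ZMod N) * (δ : ZMod N) = 1 := by
    have h1 := congrArg (fun z : ℤ ↦ (z : ZMod N)) hdet
    simp only [Int.cast_sub, Int.cast_mul, Int.cast_one, hcN, mul_zero, sub_zero] at h1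
    exact h1
  have hdd' : (d : ZMod N) * (d' : ZMod N) = 1 := by exact_mod_cast hdd
  have had : (a : ZMod N) = (d : ZMod N) := by
    linear_combination (-(a : ZMod N)) * hdd' - ((d : ZMod N) * (a : ZMod N)) * hγd + (d : ZMod N) * haδ
  -- the shift `j ≡ -bδ (N)` with `δ + jc ≠ 0`
  set j₀ : ℤ := -(b * δ) with hj₀
  set j : ℤ := if δ + j₀ * c = 0 then j₀ + N else j₀ with hj
  have hjN : (j : ZMod N) = (j₀ : ZMod N) := by
    rw [hj]; split_ifs <;> simp
  have hj10 : δ + j * c ≠ 0 := by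
    rw [hj]
    split_ifs with h0
    · have hc0 : c ≠ 0 := by
        rintro hc0
        rw [hc0, mul_zero, add_zero] at h0
        rw [h0, hc0, mul_zero, mul_zero, sub_zero] at hdet
        exact zero_ne_one hdet
      intro h1
      have h2 : (N : ℤ) * c = 0 := by linear_combination h1 - h0
      exact mul_ne_zero (by exact_mod_cast NeZero.ne N) hc0 h2
    · exact h0
  -- the two matrices `S` and `γ′ = γ T^j S`
  set S₀ : SL(2, ℤ) := ⟨!![0, -1; 1, 0], by simp [Matrix.det_fin_two_of]⟩ with hS₀
  set γ' : SL(2, ℤ) := ⟨!![b + j * a, -a; δ + j * c, -c], by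
    rw [Matrix.det_fin_two_of]; linear_combination hdet⟩ with hγ'
  have hS10 : (S₀ 1 0 : ℤ) ≠ 0 := by simp [hS₀]
  have eγ'00 : (γ' 0 0 : ℤ) = b + j * a := by simp [hγ']
  have eγ'01 : (γ' 0 1 : ℤ) = -a := by simp [hγ']
  have eγ'10 : (γ' 1 0 : ℤ) = δ + j * c := by simp [hγ']
  have eγ'11 : (γ' 1 1 : ℤ) = -c := by simp [hγ']
  have hγ'10 : (γ' 1 0 : ℤ) ≠ 0 := by rw [eγ'10]; exact hj10
  have h00 : ((γ' 0 0 : ℤ) : ZMod N) = ((S₀ 0 0 : ℤ) : ZMod N) := by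
    rw [eγ'00, show (S₀ 0 0 : ℤ) = 0 by simp [hS₀]]
    push_cast
    rw [hjN, hj₀]
    push_cast
    linear_combination (-(b : ZMod N)) * haδ
  have h01 : ((γ' 0 1 : ℤ) : ZMod N) = (d : ZMod N) * ((S₀ 0 1 : ℤ) : ZMod N) := by
    rw [eγ'01, show (S₀ 0 1 : ℤ) = -1 by simp [hS₀]]
    push_cast
    rw [had, mul_neg_one]
  have h10 : ((γ' 1 0 : ℤ) : ZMod N) = (d' : ZMod N) * ((S₀ 1 0 : ℤ) : ZMod N) := by
    rw [eγ'10, show (S₀ 1 0 : ℤ) = 1 by simp [hS₀]]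
    push_cast
    rw [hcN, mul_zero, add_zero, mul_one, ← hγd]
  have h11 : ((γ' 1 1 : ℤ) : ZMod N) = ((S₀ 1 1 : ℤ) : ZMod N) := by
    rw [eγ'11, show (S₀ 1 1 : ℤ) = 0 by simp [hS₀]]
    push_cast
    rw [hcN, neg_zero]
  -- Stevens (b) for the pair `(S, γ′)`
  have hT := map_uniformize_cusp_general D₁ σ hdd hσ S₀ γ' hS10 hγ'10 h00 h01 h10 h11
  have e0 : (((S₀ 0 0 : ℤ) : ℚ) / ((S₀ 1 0 : ℤ) : ℚ)) = 0 := by simp [hS₀]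
  -- Manin's relation `{∞, γ j} = {∞, γ∞} + {∞, j}` and `{∞, j} = {∞, 0}`
  have hr : ((c : ℤ) : ℚ) * (j : ℚ) + ((δ : ℤ) : ℚ) ≠ 0 := by
    have h : ((δ + j * c : ℤ) : ℚ) ≠ 0 := by exact_mod_cast hj10
    push_cast at h
    intro h'
    exact h (by linear_combination h')
  have hM := modularSymbol_gamma0_smul_holds D₁.f γ (j : ℚ) hr
  have e1 : (((γ' 0 0 : ℤ) : ℚ) / ((γ' 1 0 : ℤ) : ℚ)) =
      (((a : ℤ) : ℚ) * (j : ℚ) + ((b : ℤ) : ℚ)) / (((c : ℤ) : ℚ) * (j : ℚ) + ((δ : ℤ) : ℚ)) := by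
    rw [eγ'00, eγ'10]
    push_cast
    ring
  have hjz : modularSymbol D₁.f (j : ℚ) = modularSymbol D₁.f 0 := by
    simpa using modularSymbol_add_intCast_holds D₁.f 0 j
  have hsym : modularSymbol D₁.f (((γ' 0 0 : ℤ) : ℚ) / ((γ' 1 0 : ℤ) : ℚ)) = modularSymbol D₁.f 0 + cuspSymbol D₁.f γ := by
    rw [e1, hM, hjz, add_comm]
  rw [e0, hsym] at hT
  exact hT

/-! ## §3 The named fact and its converse -/

/-- **`optimalGamma1Parametrization_cuspZero_galoisConjugate` HOLDS** (Stevens 1982 Thm 1.3.1 (b) at the cusp `0`, as typed; `D.IsOptimal`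
unused): for every `γ = (a b; c δ) ∈ Γ₀(N)` some `σ ∈ Aut_ℚ(ℂ)` (any one with `σ(ζ_N) = ζ_N^a`) maps `u(c_D{∞,0})` to `u(c_D({∞,0} + {∞,γ∞}))`.
[cite: Stevens1982, §1.3 Thm. 1.3.1 (b)] [cite: ConradEdixhovenStein2003, §6.1.2 proof of Lemma 6.1.6 (p. 381)] -/
theorem optimalGamma1Parametrization_cuspZero_galoisConjugate_holds : optimalGamma1Parametrization_cuspZero_galoisConjugate := by
  intro W _ N _ D _ γ
  classical
  have hdet : ((γ : SL(2, ℤ)) 0 0 : ℤ) * (γ : SL(2, ℤ)) 1 1 - (γ : SL(2, ℤ)) 0 1 * (γ : SL(2, ℤ)) 1 0 = 1 := by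
    rw [← Matrix.det_fin_two, (γ : SL(2, ℤ)).det_coe]
  have hcN : (((γ : SL(2, ℤ)) 1 0 : ℤ) : ZMod N) = 0 := Gamma0_mem.mp γ.2
  have h1 : (((γ : SL(2, ℤ)) 0 0 : ℤ) : ZMod N) * (((γ : SL(2, ℤ)) 1 1 : ℤ) : ZMod N) = 1 := by
    have h := congrArg (fun z : ℤ ↦ (z : ZMod N)) hdet
    simp only [Int.cast_sub, Int.cast_mul, Int.cast_one, hcN, mul_zero, sub_zero] at h
    exact h
  have hdd : ((((γ : SL(2, ℤ)) 0 0 : ℤ) * ((γ : SL(2, ℤ)) 1 1 : ℤ) : ℤ) : ZMod N) = 1 := by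
    push_cast; exact h1
  obtain ⟨σ, hσ⟩ := exists_algEquiv_exp_eq (N := N) (isUnit_iff_exists_inv.mpr ⟨_, h1⟩)
  exact ⟨σ, map_uniformize_cuspZero_general D σ hdd hσ γ rfl⟩

/-- **Converse: the `Aut_ℚ(ℂ)`-orbit of the cusp-`0` value lies in `{u(c_D{∞,γ0}) : γ ∈ Γ₀(N)}`.**  For every `σ ∈ Aut_ℚ(ℂ)` there is
`γ ∈ Γ₀(N)` (any lift of `diag(d, d′)`, `σ(ζ_N) = ζ_N^d`) with `σ(u(c_D{∞,0})) = u(c_D({∞,0} + {∞,γ∞}))`.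
[cite: Stevens1982, §1.3 Thm. 1.3.1 (a)(b)] [cite: ShimuraIATAF1971, Lemma 1.38] -/
theorem exists_gamma0_map_uniformize_cuspZero {W : WeierstrassCurve ℚ} [W.IsElliptic] (D₁ : Gamma1ParametrizationData W N)
    (σ : ℂ ≃ₐ[ℚ] ℂ) :
    ∃ γ : Gamma0 N, WeierstrassCurve.Affine.Point.map (W' := W) (σ : ℂ →ₐ[ℚ] ℂ)
        (D₁.uniformize ((D₁.c : ℂ) * modularSymbol D₁.f 0)) =
      D₁.uniformize ((D₁.c : ℂ) * (modularSymbol D₁.f 0 + cuspSymbol D₁.f γ)) := by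
  classical
  obtain ⟨d, d', hdd, hσ⟩ := exists_exp_conj_pow (N := N) σ
  have hdetM : Matrix.det !![(d : ZMod N), 0; 0, (d' : ZMod N)] = 1 := by
    have h2 : (d : ZMod N) * (d' : ZMod N) = 1 := by exact_mod_cast hdd
    rw [Matrix.det_fin_two_of]
    linear_combination h2
  obtain ⟨γ₁, hγ₁⟩ := specialLinearGroup_map_surjective N ⟨_, hdetM⟩
  have hent : ∀ i k : Fin 2, ((γ₁ i k : ℤ) : ZMod N) = !![(d : ZMod N), 0; 0, (d' : ZMod N)] i k := by
    intro i k
    have h := congrArg (fun m : SL(2, ZMod N) ↦ (m : Matrix (Fin 2) (Fin 2) (ZMod N)) i k) hγ₁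
    simpa using h
  have h10 : ((γ₁ 1 0 : ℤ) : ZMod N) = 0 := by simpa using hent 1 0
  have h11 : ((γ₁ 1 1 : ℤ) : ZMod N) = (d' : ZMod N) := by simpa using hent 1 1
  exact ⟨⟨γ₁, Gamma0_mem.mpr h10⟩, map_uniformize_cuspZero_general D₁ σ hdd hσ ⟨γ₁, Gamma0_mem.mpr h10⟩ h11⟩

end Summit.BirchSwinnertonDyer.BirchSwinnertonDyer.Theorems.ManinLocalTwoThree.StevensGalois

end
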